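import Literature.Combinatorics.SimpleGraph.FKPseudomoments
import HarnessLib

/-!
# Kunisky–Yu's filled matrix `H` as a quadratic form in vertex coordinates

Continuation of `FKPseudomoments.lean` (Kunisky–Yu 2022, arXiv:2211.02713, §3.1). The matrix
`H = kyFilledMatrix G α` is indexed by singletons and pairs of vertices; for the analysis of §3.2–§4
one works instead with a vertex vector `u ∈ ℝ^V` (the singleton block) and a symmetric zero-diagonal
matrix `Vm ∈ ℝ^{V×V}` (the pair block, `Vm_{ab} = v_{{a,b}}`). This file performs that change of
coordinates once and for all:

* `kyEntry G α L R = α_{|L∪R|} 1_{|L|,|R|}(L,R) − α_{|L|}α_{|R|}` — the uniform entry formula of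
  KY (35)–(37) as a function of two finsets, `kyEntry_comm`.
* `kyVertexForm G α u Vm` — the quadratic form `zᵀ H z` written in vertex coordinates:
  `Σ_{a,b} u_a u_b H({a},{b}) + Σ_{a,c,d} u_a Vm_{cd} H({a},{c,d})
   + ¼ Σ_{a,b,c,d} Vm_{ab}Vm_{cd} H({a,b},{c,d})`
  (each unordered pair is counted twice, whence the factors).
* `sum_card_two_eq_half_sum` — `Σ_{|S| = 2} f(S) = ½ Σ_{a ≠ b} f({a,b})`;
  `sum_pairIdx_eq_sum_add_sum`
  — a sum over singletons-and-pairs splits.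
* `posSemidef_kyFilledMatrix_of_vertexForm` — **if `kyVertexForm G α u Vm ≥ 0` for all `u` and all
  symmetric zero-diagonal `Vm`, then `H ⪰ 0`** (hence, by `FKPseudomoments.lean`, the FK
  pseudomoments are Lasserre-feasible and `|V| α₁ ≤ las⁽²⁾(Ḡ)`:
  `card_mul_le_lasserreStableBound_of_vertexForm`).

## References

* [KuniskyYu2022] D. Kunisky, X. Yu, arXiv:2211.02713, §3.1 (29), (35)–(37), §3.2.
-/

noncomputable section

namespace Literature.Combinatorics.SimpleGraph

open Matrix Finset

section VertexForm

variable {V : Type*} [Fintype V] [DecidableEq V] (G : _root_.SimpleGraph V) [DecidableRel G.Adj]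

/-- The uniform entry formula of Kunisky–Yu's `H` ((35)–(37)) on two finsets:
`α_{|L∪R|} 1_{|L|,|R|}(L, R) − α_{|L|} α_{|R|}`. [cite: KuniskyYu2022, (35)–(37)] -/
def kyEntry (α : ℕ → ℝ) (L R : Finset V) : ℝ :=
  α (L ∪ R).card * bipInd G L R - α L.card * α R.card

omit [Fintype V] in
/-- `kyFilledMatrix` is `kyEntry` on the index subtype. [cite: KuniskyYu2022, (35)–(37)] -/
theorem kyFilledMatrix_eq_kyEntry (α : ℕ → ℝ) (L R : PairIdx V) :
    kyFilledMatrix G α L R = kyEntry G α L.1 R.1 := rfl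

omit [Fintype V] in
/-- The bipartite indicator is symmetric. [cite: KuniskyYu2022, Definition 3.4] -/
theorem bipInd_comm (L R : Finset V) : bipInd G L R = bipInd G R L := by
  simp only [bipInd_apply]
  have h : (∀ v ∈ L \ R, ∀ w ∈ R \ L, G.Adj v w) ↔ ∀ v ∈ R \ L, ∀ w ∈ L \ R, G.Adj v w :=
    ⟨fun h v hv w hw => (h w hw v hv).symm, fun h v hv w hw => (h w hw v hv).symm⟩
  by_cases hc : ∀ v ∈ L \ R, ∀ w ∈ R \ L, G.Adj v w
  · rw [if_pos hc, if_pos (h.1 hc)]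
  · rw [if_neg hc, if_neg (fun h' => hc (h.2 h'))]

omit [Fintype V] in
/-- `H` is symmetric: `kyEntry L R = kyEntry R L`. [cite: KuniskyYu2022, (35)–(37)] -/
theorem kyEntry_comm (α : ℕ → ℝ) (L R : Finset V) : kyEntry G α L R = kyEntry G α R L := by
  rw [kyEntry, kyEntry, union_comm, bipInd_comm, mul_comm (α L.card)]

/-- **`zᵀ H z` in vertex coordinates** (`u` = singleton block, `Vm` = pair block as a symmetric
zero-diagonal matrix; every unordered pair `{c,d}` appears as `(c,d)` and `(d,c)`).
[cite: KuniskyYu2022, §3.2] -/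
def kyVertexForm (α : ℕ → ℝ) (u : V → ℝ) (Vm : Matrix V V ℝ) : ℝ :=
  ∑ a, ∑ b, u a * u b * kyEntry G α {a} {b} +
    ∑ a, ∑ c, ∑ d, u a * Vm c d * kyEntry G α {a} {c, d} +
    (1 / 4) * ∑ a, ∑ b, ∑ c, ∑ d, Vm a b * Vm c d * kyEntry G α {a, b} {c, d}

/-! ### Two counting lemmas -/

omit [DecidableEq V] in
/-- **Double counting of pairs**: `Σ_{|S| = 2} f(S) = ½ Σ_a Σ_b [a ≠ b] f({a, b})`. [folklore] -/
theorem sum_card_two_eq_half_sum [DecidableEq V] (f : Finset V → ℝ) :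
    ∑ S : {S : Finset V // S.card = 2}, f S.1 =
      (1 / 2) * ∑ a, ∑ b, if a = b then 0 else f {a, b} := by
  -- ordered distinct pairs
  set s : Finset (V × V) := (univ ×ˢ univ).filter fun p => p.1 ≠ p.2 with hs
  have h1 : ∑ S : {S : Finset V // S.card = 2}, f S.1 =
      ∑ S ∈ (univ : Finset V).powersetCard 2, f S :=
    (Finset.sum_subtype _ (fun S => by simp [mem_powersetCard]) f).symm
  have h2 : ∑ a, ∑ b, (if a = b then 0 else f {a, b}) = ∑ p ∈ s, f {p.1, p.2} := by
    rw [hs, Finset.sum_filter, Finset.sum_product]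
    refine Finset.sum_congr rfl fun a _ => Finset.sum_congr rfl fun b _ => ?_
    by_cases hab : a = b <;> simp [hab]
  have h3 : ∑ p ∈ s, f {p.1, p.2} = ∑ S ∈ (univ : Finset V).powersetCard 2,
      ∑ p ∈ s with ({p.1, p.2} : Finset V) = S, f {p.1, p.2} := by
    refine (Finset.sum_fiberwise_of_maps_to (g := fun p : V × V => ({p.1, p.2} : Finset V))
      (fun p hp => ?_) _).symm
    rw [hs, mem_filter] at hp
    simp [mem_powersetCard, card_pair hp.2]
  have h4 : ∀ S ∈ (univ : Finset V).powersetCard 2,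
      ∑ p ∈ s with ({p.1, p.2} : Finset V) = S, f {p.1, p.2} = 2 * f S := by
    intro S hS
    obtain ⟨a, b, hab, rfl⟩ := card_eq_two.1 (mem_powersetCard.1 hS).2
    have hfil : (s.filter fun p : V × V => ({p.1, p.2} : Finset V) = {a, b}) =
        {(a, b), (b, a)} := by
      ext ⟨x, y⟩
      simp only [hs, mem_filter, mem_product, mem_univ, true_and, mem_insert, mem_singleton,
        Prod.mk.injEq]
      constructor
      · rintro ⟨hxy, h⟩
        have h' : ({x, y} : Set V) = {a, b} := by
          rw [← coe_pair, ← coe_pair, h]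
        rcases Set.pair_eq_pair_iff.1 h' with ⟨rfl, rfl⟩ | ⟨rfl, rfl⟩
        · exact Or.inl ⟨rfl, rfl⟩
        · exact Or.inr ⟨rfl, rfl⟩
      · rintro (⟨rfl, rfl⟩ | ⟨rfl, rfl⟩)
        · exact ⟨hab, rfl⟩
        · exact ⟨Ne.symm hab, pair_comm _ _⟩
    rw [hfil, sum_pair (fun h => hab (Prod.mk.injEq _ _ _ _ ▸ h).1)]
    simp only [pair_comm b a]
    ring
  rw [h1, h2, h3, Finset.sum_congr rfl h4, ← Finset.mul_sum]
  ring

omit [DecidableEq V] in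
/-- Splitting a sum over singletons-and-pairs into singletons and pairs. [folklore] -/
theorem sum_pairIdx_eq_sum_add_sum [DecidableEq V] (f : PairIdx V → ℝ) :
    ∑ L, f L = ∑ a, f ⟨{a}, by simp⟩ +
      ∑ S : {S : Finset V // S.card = 2}, f ⟨S.1, by have := S.2; omega⟩ := by
  let e : V ⊕ {S : Finset V // S.card = 2} → PairIdx V :=
    fun x => x.elim (fun a => ⟨{a}, by simp⟩) (fun S => ⟨S.1, by have := S.2; omega⟩)
  have he : Function.Bijective e := by
    constructor
    · rintro (a | ⟨S, hS⟩) (b | ⟨T, hT⟩) h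
      · have h' : ({a} : Finset V) = {b} := congrArg Subtype.val h
        rw [singleton_inj.1 h']
      · have h' : ({a} : Finset V) = T := congrArg Subtype.val h
        have : T.card = 1 := by rw [← h', card_singleton]
        omega
      · have h' : S = {b} := congrArg Subtype.val h
        have : S.card = 1 := by rw [h', card_singleton]
        omega
      · have h' : S = T := congrArg Subtype.val h
        subst h'
        rfl
    · rintro ⟨L, hL1, hL2⟩
      by_cases h : L.card = 1
      · obtain ⟨a, rfl⟩ := card_eq_one.1 h
        exact ⟨Sum.inl a, rfl⟩
      · exact ⟨Sum.inr ⟨L, by omega⟩, rfl⟩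
  rw [← Fintype.sum_bijective e he (fun x => f (e x)) f (fun _ => rfl), Fintype.sum_sum_type]
  rfl

/-! ### `H ⪰ 0` from the vertex form -/

/-- **If the vertex form is nonnegative on symmetric zero-diagonal `Vm`, then `H ⪰ 0`.** For
`z ∈ ℝ^{PairIdx}` put `u_a = z_{{a}}` and `Vm_{ab} = z_{{a,b}}` (`a ≠ b`), `Vm_{aa} = 0`; then
`zᵀ H z = kyVertexForm G α u Vm`. [cite: KuniskyYu2022, §3.2] -/
theorem posSemidef_kyFilledMatrix_of_vertexForm (α : ℕ → ℝ)
    (h : ∀ (u : V → ℝ) (Vm : Matrix V V ℝ), Vmᵀ = Vm → (∀ a, Vm a a = 0) →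
      0 ≤ kyVertexForm G α u Vm) :
    (kyFilledMatrix G α).PosSemidef := by
  classical
  refine PosSemidef.of_dotProduct_mulVec_nonneg ?_ fun z => ?_
  · ext L R
    rw [conjTranspose_apply, star_trivial, kyFilledMatrix_eq_kyEntry, kyFilledMatrix_eq_kyEntry,
      kyEntry_comm]
  -- vertex coordinates
  let zh : Finset V → ℝ := fun S => if hS : S.card = 2 then z ⟨S, by omega⟩ else 0
  let u : V → ℝ := fun a => z ⟨{a}, by simp⟩
  let Vm : Matrix V V ℝ := of fun a b => if a = b then 0 else zh {a, b}
  have hVt : Vmᵀ = Vm := by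
    ext a b
    simp only [Vm, transpose_apply, of_apply]
    by_cases hab : a = b
    · subst hab; rfl
    · rw [if_neg hab, if_neg (Ne.symm hab), pair_comm]
  have hVd : ∀ a, Vm a a = 0 := fun a => by simp [Vm]
  have hzh : ∀ S : {S : Finset V // S.card = 2}, zh S.1 = z ⟨S.1, by have := S.2; omega⟩ := by
    intro S; simp only [zh, dif_pos S.2]
  -- the quadratic form, block by block
  have hE : star z ⬝ᵥ (kyFilledMatrix G α *ᵥ z) = ∑ L, ∑ R, z L * z R * kyEntry G α L.1 R.1 := by
    simp only [star_trivial, dotProduct, mulVec, kyFilledMatrix_eq_kyEntry, Finset.mul_sum]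
    exact Finset.sum_congr rfl fun L _ => Finset.sum_congr rfl fun R _ => by ring
  have hpair : ∀ (F : Finset V → ℝ), ∑ S : {S : Finset V // S.card = 2},
      z ⟨S.1, by have := S.2; omega⟩ * F S.1 = (1 / 2) * ∑ c, ∑ d, Vm c d * F {c, d} := by
    intro F
    have h1 := sum_card_two_eq_half_sum (fun S => zh S * F S)
    simp only [hzh] at h1
    rw [h1]
    congr 1
    refine Finset.sum_congr rfl fun c _ => Finset.sum_congr rfl fun d _ => ?_
    simp only [Vm, of_apply]
    by_cases hcd : c = d
    · rw [if_pos hcd, if_pos hcd, zero_mul]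
    · rw [if_neg hcd, if_neg hcd]
  rw [hE, sum_pairIdx_eq_sum_add_sum]
  simp only [sum_pairIdx_eq_sum_add_sum (fun R => z _ * z R * kyEntry G α _ R.1)]
  simp only [Finset.sum_add_distrib]
  -- block (1,1)
  have b11 : ∑ a, ∑ b, z ⟨{a}, by simp⟩ * z ⟨{b}, by simp⟩ * kyEntry G α {a} {b} =
      ∑ a, ∑ b, u a * u b * kyEntry G α {a} {b} := rfl
  -- block (1,2)
  have b12 : ∑ a, ∑ S : {S : Finset V // S.card = 2}, z ⟨{a}, by simp⟩ *
      z ⟨S.1, by have := S.2; omega⟩ * kyEntry G α {a} S.1 =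
        (1 / 2) * ∑ a, ∑ c, ∑ d, u a * Vm c d * kyEntry G α {a} {c, d} := by
    rw [Finset.mul_sum]
    refine Finset.sum_congr rfl fun a _ => ?_
    have h1 := hpair (fun S => u a * kyEntry G α {a} S)
    have e1 : ∑ S : {S : Finset V // S.card = 2}, z ⟨{a}, by simp⟩ *
        z ⟨S.1, by have := S.2; omega⟩ * kyEntry G α {a} S.1 =
          ∑ S : {S : Finset V // S.card = 2}, z ⟨S.1, by have := S.2; omega⟩ *
            (u a * kyEntry G α {a} S.1) := Finset.sum_congr rfl fun S _ => by simp only [u]; ring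
    rw [e1, h1, Finset.mul_sum, Finset.mul_sum]
    refine Finset.sum_congr rfl fun c _ => ?_
    rw [Finset.mul_sum, Finset.mul_sum]
    exact Finset.sum_congr rfl fun d _ => by ring
  -- block (2,1)
  have b21 : ∑ S : {S : Finset V // S.card = 2}, ∑ b, z ⟨S.1, by have := S.2; omega⟩ *
      z ⟨{b}, by simp⟩ * kyEntry G α S.1 {b} =
        (1 / 2) * ∑ a, ∑ c, ∑ d, u a * Vm c d * kyEntry G α {a} {c, d} := by
    rw [Finset.sum_comm, Finset.mul_sum]
    refine Finset.sum_congr rfl fun a _ => ?_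
    have h1 := hpair (fun S => u a * kyEntry G α {a} S)
    have e1 : ∑ S : {S : Finset V // S.card = 2}, z ⟨S.1, by have := S.2; omega⟩ *
        z ⟨{a}, by simp⟩ * kyEntry G α S.1 {a} =
          ∑ S : {S : Finset V // S.card = 2}, z ⟨S.1, by have := S.2; omega⟩ *
            (u a * kyEntry G α {a} S.1) :=
      Finset.sum_congr rfl fun S _ => by simp only [u]; rw [kyEntry_comm]; ring
    rw [e1, h1, Finset.mul_sum, Finset.mul_sum]
    refine Finset.sum_congr rfl fun c _ => ?_
    rw [Finset.mul_sum, Finset.mul_sum]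
    exact Finset.sum_congr rfl fun d _ => by ring
  -- block (2,2)
  have b22 : ∑ S : {S : Finset V // S.card = 2}, ∑ T : {S : Finset V // S.card = 2},
      z ⟨S.1, by have := S.2; omega⟩ * z ⟨T.1, by have := T.2; omega⟩ * kyEntry G α S.1 T.1 =
        (1 / 4) * ∑ a, ∑ b, ∑ c, ∑ d, Vm a b * Vm c d * kyEntry G α {a, b} {c, d} := by
    have inner : ∀ S : {S : Finset V // S.card = 2},
        ∑ T : {S : Finset V // S.card = 2}, z ⟨S.1, by have := S.2; omega⟩ *
          z ⟨T.1, by have := T.2; omega⟩ * kyEntry G α S.1 T.1 =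
          z ⟨S.1, by have := S.2; omega⟩ *
            ((1 / 2) * ∑ c, ∑ d, Vm c d * kyEntry G α S.1 {c, d}) := by
      intro S
      rw [← hpair (fun T => kyEntry G α S.1 T), Finset.mul_sum]
      exact Finset.sum_congr rfl fun T _ => by ring
    simp only [inner]
    rw [hpair (fun S => (1 / 2) * ∑ c, ∑ d, Vm c d * kyEntry G α S {c, d})]
    have e2 : ∑ a, ∑ b, Vm a b * ((1 / 2) * ∑ c, ∑ d, Vm c d * kyEntry G α {a, b} {c, d}) =
        (1 / 2) * ∑ a, ∑ b, ∑ c, ∑ d, Vm a b * Vm c d * kyEntry G α {a, b} {c, d} := by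
      rw [Finset.mul_sum]
      refine Finset.sum_congr rfl fun a _ => ?_
      rw [Finset.mul_sum]
      refine Finset.sum_congr rfl fun b _ => ?_
      rw [mul_left_comm]
      refine congrArg _ ?_
      rw [Finset.mul_sum]
      refine Finset.sum_congr rfl fun c _ => ?_
      rw [Finset.mul_sum]
      exact Finset.sum_congr rfl fun d _ => by ring
    rw [e2, ← mul_assoc]
    norm_num
  rw [b11, b12, b21, b22]
  have hq := h u Vm hVt hVd
  simp only [kyVertexForm] at hq
  linarith

/-- **The FK lower bound from the vertex form**: if `kyVertexForm G α u Vm ≥ 0` for all `u` and all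
symmetric zero-diagonal `Vm` (levels with `α₀ = 1`), then `|V| α₁ ≤ las⁽²⁾(Ḡ)`.
[cite: KuniskyYu2022, §3.2 and (26)] -/
theorem card_mul_le_lasserreStableBound_of_vertexForm (α : ℕ → ℝ) (hα : α 0 = 1)
    (h : ∀ (u : V → ℝ) (Vm : Matrix V V ℝ), Vmᵀ = Vm → (∀ a, Vm a a = 0) →
      0 ≤ kyVertexForm G α u Vm) :
    Fintype.card V * α 1 ≤ lasserreStableBound Gᶜ 2 :=
  card_mul_le_lasserreStableBound_of_kyFilledMatrix G α hα
    (posSemidef_kyFilledMatrix_of_vertexForm G α h)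

end VertexForm

end Literature.Combinatorics.SimpleGraph

end
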